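import Literature.AnabelianGeometry.EtaleTheta.Discharge.Sec4NonVacuityTowerLaws
import Literature.AnabelianGeometry.EtaleTheta.Discharge.Sec5RootChainModel
import Literature.AnabelianGeometry.EtaleTheta.Discharge.Sec5RootOfRootModelSections
import Literature.AnabelianGeometry.EtaleTheta.TemperedFrobenioidLaws

/-!
# [EtTh] Rmk. 4.3.2 «compatible systems of roots» — the hypotheses of the root-family / tower-from-laws chain are JOINTLY
# SATISFIABLE and its conclusion is INHABITED at the genuine Kummer toy tower (consistency witness, part 12)

S. Mochizuki, *The étale theta function and its Frobenioid-theoretic manifestations*, Publ. RIMS **45** (2009)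
[MochizukiEtTh2009], Rmk. 4.3.2 pp. 318–319 (PDF pp. 92–93) «by allowing `N` to vary, we obtain a compatible system of
roots»; Prop. 4.2 (iii) p. 314 with ERRATUM E2; [FrdII] Rmk. 2.2.1.

abc-iut cell, layer L2.  CONSISTENCY WITNESS, TOY — PROOF-ONLY (no definition, no named fact, no instance); seat
abc-iut-w6-d053 (gen 4), sequel of abc-iut-w4-d044's / abc-iut-w6-d037's `Sec4NonVacuityTowerLaws.lean` (part 11: on the
genuine Kummer toy tower `ToyTower.biKummerSetting p` — deck transformations, `Φ = ℚ_{≥0}`, `B = ℂˣ × t^ℤ`, roots only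
upstairs — the six base-level laws of the Prop. 4.2 (iii)/(iv) floor hold and the closers fire).  Here the STRONGER law set of
abc-iut-w5-d134's `BiKummerSetting.exists_compatibleRootFamily_mkOfModelCanonical` (p439666; the engine behind this seat's
`Sec5TowerFromLawsOfConnectedTemperoid.lean`, p443359) is checked at the same toy:
* `ToyTower.refinementLawFamily` — the FAMILY-FORM refinement law `hEdiv` (GAP G-w5d134g4-1: ONE `μ_M`-saturated pull-back
  cover carrying the `(N, H_⊙^{bs-fld})`-clause at EVERY `N ∣ M`) HOLDS on the tower, with `ψ := 𝟙` (every object is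
  `μ_M`-saturated for every `M`, `ℂˣ ⊆ B`; the toy's `(N,H)`-slot is `True`);
* `ToyTower.nonempty_fractionPair` — a right fraction-pair on `A_⊙` EXISTS (the trivial pair of `1`), so the next item is
  not vacuous;
* `ToyTower.compatibleRootFamily_exists` — **for EVERY `f ∈ O^×(A_⊙^birat)` and EVERY right fraction-pair `P` of `f`, the
  compatible root FAMILY `R N` (`N ≥ 1`; skeleton clause, `μ_{l·N}`-saturation, Def. 4.1 (iii)(a) at `l·N`) TOGETHER WITH the
  Rmk. 4.3.2 transitions for all `N ∣ N′` EXISTS at the toy tower** — p439666 FIRES with {`Φ` divisorial, `hDSpull`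
  (`coprime_pull`), `hR` (`rootLaw`, E2 by the Kummer cover), `hEdiv` (`refinementLawFamily`), `hS` (`naturalityLaw`)} and the
  `H_{A_⊙}`-fixedness theorem `isFixedByHA_Aodot_mkOfModelCanonical` (abc-iut-w5-d134);
* `ToyTower.compatibleRootFamily_exists_one` — the same packaged with the witness pair: a kernel INHABITANT of the conclusion;
* `ToyTower.baseRootLaw_A10` — the toy's `B₀^Λ`-level root law (`ToyTower.baseRootLaw`, part 11) RE-KEYED on abc-iut-L2-t3's NAMED
  predicate `TemperedFrobenioid.BaseRootLaw` (census A10, `TemperedFrobenioidLaws.lean`): **A10 HAS a kernel instance at the Kummer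
  toy tower** — informative next to label F-L2t3g5-1 (abc-iut-L2-t3: A10 is UNSATISFIABLE inside the tree's `GaloisAction` Def. 3.3 (iii)
  model class, `not_baseRootLaw_top`); the toy tower lies outside that class (its `B = ℂˣ × t^ℤ` acquires roots along the Kummer
  covers `X_{N·M} → X_M`), and `Toy.not_baseRootLaw` (one-object `Λ = ℤ` toy) shows the law is not formal either.
READING (neutral): the binders of «root family + transitions ⇐ laws» (and hence of the tower-from-laws theorems over
`B^temp(Π^tp_X)⁰`, which have the same law shapes) are jointly satisfiable at a setting with deck transformations, integral
exponents and roots only upstairs.  HONEST LIMITS: a toy (𝔾_m; trivial [FrdI] vocabularies; `(N,H)`-slot `True`; Galois datum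
acting through `Π^tp_X ↠ ℤ`); consistency ≠ faithfulness; nothing here is the genuine base `B^temp(Π^tp_X)⁰`; typed ≠ proved;
no side taken on [IUTchIII] Cor. 3.12.
-/

noncomputable section

namespace Literature.AnabelianGeometry.EtaleTheta

open CategoryTheory Opposite Literature.AlgebraicGeometry.Frobenioids

namespace ToyTower

open Base

variable (p : ℕ) [Fact p.Prime]

/-- **The family-form refinement law `hEdiv` (G-w5d134g4-1) HOLDS on the toy tower**, with `ψ := 𝟙`: every object is
`μ_M`-saturated for every `M` (`isMuSaturated`) and the `(N,H)`-slot is `True`. [cite: MochizukiFrdII2008, Rmk. 2.2.1 p.52] -/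
theorem refinementLawFamily (M : ℕ+) (A' : ToyTower.temperedFrobenioid.category)
    (_hft : PreFrobenioid.IsFrobeniusTrivial ToyTower.temperedFrobenioid.toElem A') (_hG : True) :
    ∃ (A'' : ToyTower.temperedFrobenioid.category) (ψ : A'' ⟶ A'),
      PreFrobenioid.IsPullbackMorphism ToyTower.temperedFrobenioid.toElem ψ ∧ True ∧
        ToyTower.temperedFrobenioid.IsMuSaturated A'' M ∧
          ∀ N : ℕ+, (N : ℕ) ∣ (M : ℕ) → (fun (_ : Subgroup (Field.absoluteGaloisGroup (SettingModel.curveχ p).K))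
            (_ : ToyTower.temperedFrobenioid.category) (_ : ℕ+) => True)
              (ToyTower.biKummerSetting p).HodotBsFld A'' N :=
  ⟨A', 𝟙 A', ModelFrobenioid.isPullbackMorphism_of divisorMonoid_isDivisorial ratFnFunctor_isGroupLike rfl rfl, trivial,
    isMuSaturated A' M, fun _ _ => trivial⟩

/-- **A right fraction-pair on `A_⊙` EXISTS on the toy tower**: the trivial pair `(id, id)` of `f = 1` (both pre-steps,
base-equivalent, `id · id⁻¹ = 1`, `Div(id) = 0` twice with disjoint supports in the sharp `ℚ_{≥0}`).
[cite: MochizukiEtTh2009, Def 4.1 (i) p.312 (PDF p.86)] -/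
theorem nonempty_fractionPair :
    Nonempty ((ToyTower.biKummerSetting p).FractionPair (A := ToyTower.Aodot) 1 ToyTower.Aodot) :=
  ⟨{ num := 𝟙 _
     den := 𝟙 _
     isPreStep_num := ModelFrobenioid.isPreStep_id _
     isPreStep_den := ModelFrobenioid.isPreStep_id _
     base_eq := rfl
     frac_eq := ModelFrobenioid.frac_self _ _
     disjointSupports := fun x hx _ =>
       (divisorMonoid_isDivisorial ToyTower.Aodot.base).isSharp.eq_one_of_isUnit x (isUnit_of_dvd_one hx) }⟩

/-- **[EtTh] Rmk. 4.3.2 at the toy tower — the compatible root FAMILY with ALL transitions EXISTS for every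
`f ∈ O^×(A_⊙^birat)` and every right fraction-pair `P` of `f`**: abc-iut-w5-d134's
`BiKummerSetting.exists_compatibleRootFamily_mkOfModelCanonical` (p439666) FIRES at `ToyTower.biKummerSetting p` with the laws
{`Φ` divisorial, `hDSpull` := `coprime_pull`, `hR` := `rootLaw`, `hEdiv` := `refinementLawFamily`, `hS` := `naturalityLaw`},
`A := A_⊙` (skeleton clause `rfl`, Frobenius-trivial, Galois slot `True`) and the `H_{A_⊙}`-fixedness theorem
`isFixedByHA_Aodot_mkOfModelCanonical`.  [cite: MochizukiEtTh2009, Rmk 4.3.2 p.318–319 (PDF pp.92–93)] -/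
theorem compatibleRootFamily_exists {B : ToyTower.temperedFrobenioid.category}
    (f : (ToyTower.biKummerSetting p).biratUnits ToyTower.Aodot) (P : (ToyTower.biKummerSetting p).FractionPair f B)
    (lv : ℕ+) :
    ∃ R : ∀ N : ℕ+, (ToyTower.biKummerSetting p).NthRoot f P N
        (fun {_} φ x => ToyTower.temperedFrobenioid.pullFracModel φ x),
      (∀ N : ℕ+, (Nonempty ((R N).AN.base ≅ ToyTower.Aodot.base) → (R N).AN = ToyTower.Aodot) ∧
          ToyTower.temperedFrobenioid.IsMuSaturated (R N).AN (lv * N) ∧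
        ∃ (A₁ A₂ : ToyTower.temperedFrobenioid.category) (s₁ : A₁ ⟶ (R N).AN) (s₂ : A₁ ⟶ A₂),
          (ToyTower.biKummerSetting p).IsPreStep s₁ ∧ (ToyTower.biKummerSetting p).IsPreStep s₂ ∧
            (ToyTower.biKummerSetting p).IsFrobeniusTrivial A₂ ∧
              (ToyTower.biKummerSetting p).IsNHSaturatedBsFld (ToyTower.biKummerSetting p).HodotBsFld A₂ (lv * N)) ∧
      ∀ (N N' : ℕ+), (N : ℕ) ∣ (N' : ℕ) → ∃ (α : (R N').AN ⟶ (R N).AN) (β : (R N').BN ⟶ (R N).BN),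
        (R N').pair.num ≫ β = α ≫ (R N).pair.num ∧ (R N').pair.den ≫ β = α ≫ (R N).pair.den ∧
          (ToyTower.biKummerSetting p).IsIsometry α ∧ ((ToyTower.biKummerSetting p).degFr α : ℕ) * N = N' ∧
            (ToyTower.biKummerSetting p).IsIsometry β ∧ ((ToyTower.biKummerSetting p).degFr β : ℕ) * N = N' ∧
              (ToyTower.biKummerSetting p).IsOfBaseFrobeniusType α :=
  BiKummerSetting.exists_compatibleRootFamily_mkOfModelCanonical (ToyTower.temperedGroup p) ToyTower.temperedFrobenioid
    temperedFrobenioid_monoidType temperedFrobenioid_isPerfect (fun _ => True) (ToyTower.galoisSurj p)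
    (galoisSurj_surjective p) (fun _ _ _ => True) ToyTower.Aodot isFrobeniusTrivial_Aodot trivial divisorMonoid_isDivisorial
    (fun e _ _ h y hya hyb => coprime_pull e h y hya hyb) rootLaw (refinementLawFamily p) (naturalityLaw p)
    isFrobeniusTrivial_Aodot trivial (fun _ => rfl)
    (BiKummerSetting.isFixedByHA_Aodot_mkOfModelCanonical (ToyTower.temperedGroup p) ToyTower.temperedFrobenioid
      temperedFrobenioid_monoidType temperedFrobenioid_isPerfect (fun _ => True) (ToyTower.galoisSurj p)
      (galoisSurj_surjective p) (fun _ _ _ => True) ToyTower.Aodot isFrobeniusTrivial_Aodot trivial f)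
    P lv

/-- **A kernel INHABITANT of the conclusion**: on the toy tower there are a right fraction-pair `P` of `1 ∈ O^×(A_⊙^birat)` and
a compatible family of `N`-th root data of `P` for all `N ≥ 1` with the Rmk. 4.3.2 transitions for all `N ∣ N′` (here `l := 1`).
[cite: MochizukiEtTh2009, Rmk 4.3.2 p.318–319 (PDF pp.92–93)] -/
theorem compatibleRootFamily_exists_one :
    ∃ (P : (ToyTower.biKummerSetting p).FractionPair (A := ToyTower.Aodot) 1 ToyTower.Aodot)
      (R : ∀ N : ℕ+, (ToyTower.biKummerSetting p).NthRoot 1 P N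
        (fun {_} φ x => ToyTower.temperedFrobenioid.pullFracModel φ x)),
      (∀ N : ℕ+, (Nonempty ((R N).AN.base ≅ ToyTower.Aodot.base) → (R N).AN = ToyTower.Aodot) ∧
          ToyTower.temperedFrobenioid.IsMuSaturated (R N).AN (1 * N)) ∧
      ∀ (N N' : ℕ+), (N : ℕ) ∣ (N' : ℕ) → ∃ (α : (R N').AN ⟶ (R N).AN) (β : (R N').BN ⟶ (R N).BN),
        (R N').pair.num ≫ β = α ≫ (R N).pair.num ∧ (R N').pair.den ≫ β = α ≫ (R N).pair.den ∧
          (ToyTower.biKummerSetting p).IsIsometry α ∧ ((ToyTower.biKummerSetting p).degFr α : ℕ) * N = N' ∧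
            (ToyTower.biKummerSetting p).IsIsometry β ∧ ((ToyTower.biKummerSetting p).degFr β : ℕ) * N = N' ∧
              (ToyTower.biKummerSetting p).IsOfBaseFrobeniusType α :=
  (nonempty_fractionPair p).elim fun P =>
    (compatibleRootFamily_exists p 1 P 1).elim fun R hR =>
      ⟨P, R, fun N => ⟨(hR.1 N).1, (hR.1 N).2.1⟩, hR.2⟩

/-- **The NAMED law A10 `TemperedFrobenioid.BaseRootLaw` HOLDS on the toy tower** (re-key of part 11's `ToyTower.baseRootLaw`,
VERBATIM the predicate's body with `IG := ⊤`): a kernel instance of census A10 outside the `GaloisAction` model class of label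
F-L2t3g5-1.  [cite: MochizukiEtTh2009, Prop 4.2 (iii) p.315 (PDF p.89)] -/
theorem baseRootLaw_A10 : ToyTower.temperedFrobenioid.BaseRootLaw (fun _ : Base => True) :=
  fun N A hA b => baseRootLaw N A hA b

end ToyTower

end Literature.AnabelianGeometry.EtaleTheta

end
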